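import Summits.BirchSwinnertonDyer.BirchSwinnertonDyer.Theorems.KolyvaginDepthDoorDepthTableSteinWuthrich
import Summits.BirchSwinnertonDyer.BirchSwinnertonDyer.Theorems.KolyvaginDepthDoorDepthTableSteinWuthrichEvenRankBSDQuotient
import Summits.BirchSwinnertonDyer.BirchSwinnertonDyer.Theorems.Rank1ResidualIntModelSurjectivity
import Summits.BirchSwinnertonDyer.Rank1Residual.Additive.PointCountEulerNat
import Literature.NumberTheory.EllipticCurves.GlobalMinimalModelNumberFieldBaseChangeProofs
import Literature.NumberTheory.EllipticCurves.LocalReductionKrausMinimality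
import Literature.NumberTheory.EllipticCurves.SelmerTorsionTwistRestriction
import Literature.NumberTheory.EllipticCurves.ComplexMultiplicationNotSemistable
import HarnessLib

/-!
# Route `KolyvaginDepthDoor`, crux `KolyvaginDepthSupplyKN` (stmt-BirchSwinnertonDyer-22820) —
# DEPTH TABLE v15: the RANK-ONE DATUM of the even-rank row `389a1` at `(p, d_K) = (5, -7)` READ AS ONE BSD-QUOTIENT VALUATION
# (Burungale–Castella–Skinner 2025 Cor. 1.3.1 and Gross–Zagier–Kolyvagin BY NAME on a kernel-certified minimal model of the twist)

Helper file of the lead prover of line `levelone` (kdd-p1 g19; `--supports stmt-BirchSwinnertonDyer-22820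
--as helper`); it closes nothing and BSD is NOT proved by it.

The v13 row of `389a1` (g17, `C389a1.cruxBody_of_twistSelmer`) leaves ONE datum: `#Sel_5(E^{(-7)}/ℚ) ≤ 5` for the Heegner twist
`T = E^{(-7)}`, a curve of analytic rank ONE (root number `−1`; observatory numerics `CERT-TABLE.md`, cert-2 g40: `r_an(T) = 1`,
`#Ш_an(T) = 1.000…`, `5 ∤ c(T)`, `#T(ℚ)_tors = 1` — context only). g18 read the ODD-rank rows through Skinner 2016 Thm. C on the
rank-ZERO twist; this file is the EVEN-rank counterpart: the printed `p`-part of BSD IN ANALYTIC RANK ONE (Burungale–Castella–Skinner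
2025 Cor. 1.3.1: any conductor; non-CM, `p > 3` good ordinary, `E[p]` irreducible, (im)) turns the datum into ONE valuation of ONE
rational number, the BSD quotient `L'(T,1)/(Ω_T·Reg_T)` (`= #Ш_an(T)·Tam(T)/#T(ℚ)_tors²`).

`T` has the GLOBAL MINIMAL MODEL `T₀ = [0, -1, 1, -114, -302]` (`Δ(T₀) = 45765461 = 7^6 · 389`), `ℚ`-isomorphic to the tree's
`E.quadraticTwist (-7)` by `(u, r, s, t) = (1, -2, 0, -1/2)` (`minTwist7_smul_eq`). Kernel certificates (all `decide`): `minTwist7_isElliptic`,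
`minTwist7_isGloballyMinimal` (Silverman's `Δ`-criterion (`Δ` is 12th-power-free)), `minTwist7_intModel`, `minTwist7_card_5` (`#T̃₀(𝔽_5) = 3`, `a_5(T) = 3`: good ORDINARY),
Serre's Prop. 19 witnesses `minTwist7_hasSurjectiveModNGaloisRep_5` (`ρ̄_{T,5}` onto; `T` is additive at ``7``, so Prop. 21 is unavailable),
`minTwist7_not_hasCM` (multiplicative at `389`), `minTwist7_kodairaNeron_5` (`5 ∤ ord_v Δ_T` at multiplicative `v`, hence `5 ∤ Tam(T)`).

* `minTwist7_natCard_selmerGroup_eq_of_bsdQuotient` — **BCS Cor. 1.3.1 + GZK ⟹ the datum.** IF `ord_{s=1} L(T,s) = 1` and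
  `ord_5(L'(T,1)/(Ω_T·Reg_T)) ≤ 0`, THEN `#Sel_5(T/ℚ) = 5` (generic `natCard_selmerGroup_eq_of_rankOne_bsdQuotient_bcs`:
  GZK gives rank `1` and `Ш(T)` finite; BCS gives `ord_5` of the quotient `= ord_5 #Ш(T) + ord_5 Tam(T)`; Kodaira–Néron kills the
  Tamagawa term; so `5 ∤ #Ш(T)`, `Ш(T)[5] = 0`, `#Sel_5 = 5^rank = 5`).
* `natCard_selmerGroup_quadraticTwist_neg7_eq_of_bsdQuotient` — the same transported to `E.quadraticTwist (-7)`
  (`natCard_selmerGroup_eq_of_variableChange`).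
* `cruxBody_of_twistBSDQuotient` — composed with `C389a1.cruxBody_of_twistSelmer` (g17): the CLAUSE of the crux at `W = 389a1` VERBATIM
  from the two rank-one hypotheses, for every imaginary quadratic `K` with `d_K = -7`.

So, modulo the named print facts (Stein–Wuthrich 2013 Thm. 1.1, (γ) = Gross 1991 Prop. 3.7 (2), W. Zhang 2014 Lemma 8.4 (1) / Thm. 9.1; Burungale–Castella–Skinner 2025 Cor. 1.3.1; Gross–Zagier–Kolyvagin), the crux
`KolyvaginDepthSupplyKN` holds AT `389a1` as soon as ONE real number — the BSD quotient of the rank-one twist `E^{(-7)}`, rational by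
Gross–Zagier — has `5`-adic valuation `≤ 0` [and `ord_{s=1} L(T,s) = 1`]. Per curve; nothing class-wide (the open stub (S♭) is
untouched); BSD is NOT proved by any of this.

References: [BurungaleCastellaSkinner2025] Cor. 1.3.1 (p. 4); [Darmon2004] Thm. 3.22 (GZK); [Serre1972] §2.8 Prop. 19;
[SerreAbelianLadic1968] IV-23; [Kraus1989] Prop. 2; [SilvermanAEC2009] VII.1 Rem. 1.1, VIII.8, X.4.2, X.5 Cor. 5.4;
[CremonaAlgorithms1997] Table 1 (389a1), §3.2.
-/

set_option linter.dupNamespace false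

noncomputable section

open scoped Classical NumberField

namespace Summit.BirchSwinnertonDyer.BirchSwinnertonDyer.Theorems.KolyvaginDepthDoor

open Literature.NumberTheory.EllipticCurves Literature.NumberTheory.EllipticCurves.ModularForms
  WeierstrassCurve NumberField IsDedekindDomain
open Summit.BirchSwinnertonDyer.BirchSwinnertonDyer.Theorems
open Summit.BirchSwinnertonDyer.BirchSwinnertonDyer.Rank2Observatory
open Summit.BirchSwinnertonDyer.BirchSwinnertonDyer.Rank1Residual
open Summit.BirchSwinnertonDyer.Rank1Residual.Additive

namespace C389a1

/-! ## The minimal model `T₀ = [0, -1, 1, -114, -302]` of the twist `389a1^{(-7)}` -/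

/-- `T₀ = [0, -1, 1, -114, -302]` is an elliptic curve over `ℚ` (`Δ = 45765461 ≠ 0`, kernel-checked). [folklore] -/
theorem minTwist7_isElliptic : ((⟨0, -1, 1, -114, -302⟩ : WeierstrassCurve ℤ).map (Int.castRingHom ℚ)).IsElliptic := by
  rw [WeierstrassCurve.isElliptic_iff, WeierstrassCurve.map_Δ, isUnit_iff_ne_zero, eq_intCast, Int.cast_ne_zero]
  decide +kernel

/-- **`T₀ = [0, -1, 1, -114, -302]` is a GLOBAL MINIMAL model** (unconditional): `Δ(T₀) = 7^6 · 389` is twelfth-power-free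
(a prime `q` with `q¹² ∣ Δ` has `q < 5`, and none of those does), so Silverman's `Δ`-criterion
`isGloballyMinimal_baseChange_int_of_finrank_mul_lt_twelve` applies with `k = 11`. [cite: SilvermanAEC2009, VII.1 Remark 1.1 and VIII.8] -/
theorem minTwist7_isGloballyMinimal : ((⟨0, -1, 1, -114, -302⟩ : WeierstrassCurve ℤ).map (Int.castRingHom ℚ)).IsGloballyMinimal := by
  have hbc : (⟨0, -1, 1, -114, -302⟩ : WeierstrassCurve ℤ).map (Int.castRingHom ℚ) = (⟨0, -1, 1, -114, -302⟩ : WeierstrassCurve ℤ).baseChange ℚ := by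
    ext <;> simp [WeierstrassCurve.baseChange, WeierstrassCurve.map]
  rw [hbc]
  refine isGloballyMinimal_baseChange_int_of_finrank_mul_lt_twelve _ ℚ 11 (fun q hq hdvd ↦ ?_)
    (by rw [Module.finrank_self]; norm_num)
  have hΔ : (⟨0, -1, 1, -114, -302⟩ : WeierstrassCurve ℤ).Δ = (45765461 : ℕ) := by decide +kernel
  rw [hΔ] at hdvd
  have h1 : q ^ 12 ∣ 45765461 := by exact_mod_cast hdvd
  have hle : q ^ 12 ≤ 45765461 := Nat.le_of_dvd (by norm_num) h1
  have hqM : q < 5 := by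
    by_contra h
    have hM : 5 ^ 12 ≤ q ^ 12 := Nat.pow_le_pow_left (by omega) 12
    norm_num at hM
    omega
  interval_cases q <;> first | (norm_num at hq; done) | exact absurd h1 (by decide +kernel)

/-- The integral model `[0, -1, 1, -114, -302]` is its own `integralModelInt` (globally minimal). [folklore] -/
theorem minTwist7_intModel :
    haveI := minTwist7_isGloballyMinimal;
    integralModelInt ((⟨0, -1, 1, -114, -302⟩ : WeierstrassCurve ℤ).map (Int.castRingHom ℚ)) = ⟨0, -1, 1, -114, -302⟩ := by
  haveI := minTwist7_isGloballyMinimal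
  exact IntModel.integralModelInt_eq_of_map_eq _ rfl

/-- **`T₀` is `ℚ`-isomorphic to the tree's twist `E.quadraticTwist (-7)` of `E = 389a1`** by the change of variables
`(u, r, s, t) = (1, -2, 0, -1/2)`: `(u,r,s,t) • T₀ = ⟨0, d·b₂/4, 0, d²·b₄/2, d³·b₆/4⟩` with `(b₂, b₄, b₆)(E) = (4, -4, 1)`,
`d = -7`. [cite: SilvermanAEC2009, X.5 Cor. 5.4] -/
theorem minTwist7_smul_eq :
    (⟨1, (-2 : ℚ), (0 : ℚ), -((1 : ℚ) / 2)⟩ : WeierstrassCurve.VariableChange ℚ) •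
        ((⟨0, -1, 1, -114, -302⟩ : WeierstrassCurve ℤ).map (Int.castRingHom ℚ)) =
      Curve389a1.E.quadraticTwist ((-7) : ℚ) := by
  haveI := curve389a1_isGloballyMinimal
  have hE : Curve389a1.E = (⟨0, 1, 1, -2, 0⟩ : WeierstrassCurve ℤ).baseChange ℚ := by
    ext <;> simp [Curve389a1.E, WeierstrassCurve.baseChange, WeierstrassCurve.map]
  rw [hE]
  ext <;> simp only [WeierstrassCurve.map_a₁, WeierstrassCurve.map_a₂, WeierstrassCurve.map_a₃,
      WeierstrassCurve.map_a₄, WeierstrassCurve.map_a₆, WeierstrassCurve.variableChange_a₁,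
      WeierstrassCurve.variableChange_a₂, WeierstrassCurve.variableChange_a₃,
      WeierstrassCurve.variableChange_a₄, WeierstrassCurve.variableChange_a₆, WeierstrassCurve.quadraticTwist,
      WeierstrassCurve.b₂, WeierstrassCurve.b₄, WeierstrassCurve.b₆, WeierstrassCurve.baseChange, Units.val_one, inv_one,
      eq_intCast] <;> norm_num

/-- `#T̃₀(𝔽_3) = 2`, i.e. `a_3(T) = 2` (kernel-decided, `ℕ`-arithmetic Euler count). [cite: SilvermanAEC2009, V.2] -/
theorem minTwist7_card_3 :
    Nat.card (((⟨0, -1, 1, -114, -302⟩ : WeierstrassCurve ℤ).map (Int.castRingHom (ZMod 3))).toAffine.Point) = 2 := by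
  rw [PointCountNat.natCard_point_map_eq (hℓ := ⟨by norm_num⟩) (by norm_num) 0 (-1) 1 (-114) (-302)
    (by decide +kernel)]
  decide +kernel

/-- `#T̃₀(𝔽_5) = 3`, i.e. `a_5(T) = 3` (kernel-decided, `ℕ`-arithmetic Euler count). [cite: SilvermanAEC2009, V.2] -/
theorem minTwist7_card_5 :
    Nat.card (((⟨0, -1, 1, -114, -302⟩ : WeierstrassCurve ℤ).map (Int.castRingHom (ZMod 5))).toAffine.Point) = 3 := by
  rw [PointCountNat.natCard_point_map_eq (hℓ := ⟨by norm_num⟩) (by norm_num) 0 (-1) 1 (-114) (-302)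
    (by decide +kernel)]
  decide +kernel

/-- `#T̃₀(𝔽_23) = 28`, i.e. `a_23(T) = -4` (kernel-decided, `ℕ`-arithmetic Euler count). [cite: SilvermanAEC2009, V.2] -/
theorem minTwist7_card_23 :
    Nat.card (((⟨0, -1, 1, -114, -302⟩ : WeierstrassCurve ℤ).map (Int.castRingHom (ZMod 23))).toAffine.Point) = 28 := by
  rw [PointCountNat.natCard_point_map_eq (hℓ := ⟨by norm_num⟩) (by norm_num) 0 (-1) 1 (-114) (-302)
    (by decide +kernel)]
  decide +kernel

/-- **`5` is a prime of good ORDINARY reduction for `T`** (`5 ∤ Δ_T`, `a_5(T) = 3 ≢ 0`). [cite: SilvermanAEC2009, VII.5 Prop. 5.1 (a)] -/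
theorem minTwist7_goodOrdinary_5 :
    haveI := minTwist7_isGloballyMinimal;
    haveI := Fact.mk (by norm_num : Nat.Prime 5);
    ((⟨0, -1, 1, -114, -302⟩ : WeierstrassCurve ℤ).map (Int.castRingHom ℚ)).HasGoodReductionAtPrime 5 ∧
      ¬ ((5 : ℕ) : ℤ) ∣ ((⟨0, -1, 1, -114, -302⟩ : WeierstrassCurve ℤ).map (Int.castRingHom ℚ)).frobeniusTrace 5 := by
  haveI := minTwist7_isGloballyMinimal
  haveI := Fact.mk (by norm_num : Nat.Prime 5)
  exact goodOrdinary_of_intModel_certificate minTwist7_intModel 5 (by decide +kernel) (n := 3) minTwist7_card_5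
    (by decide +kernel)

/-- **`ρ̄_{T,5}` is surjective** (unconditional; `T` is ADDITIVE at the primes of `d_K`, so Serre's Prop. 21 for semistable
curves is unavailable — Serre's Prop. 19 instead, tree theorem `IntModel.hasSurjectiveModNGaloisRep_of_intModel_of_serreWitnesses`):
Frobenius witnesses i) `q = 23`, `a = -4`: `a² − 4q` a non-zero square mod `5`, `a ≢ 0`; ii) `q = 3`, `a = 2`: `a² − 4q` a
non-square, `a ≢ 0`; iii) `q = 3`, `a = 2`: `u = a²/q ≡ 3`, `u ∉ {0,1,2,4}`, `u² − 3u + 1 ≢ 0` — all kernel-decided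
(`a_q(T) = ±a_q(E)`: the Serre conditions are twist-invariant). [cite: Serre1972, §2.8 Prop. 19 and §5.2 (iii)] -/
theorem minTwist7_hasSurjectiveModNGaloisRep_5 :
    haveI := minTwist7_isGloballyMinimal;
    ((⟨0, -1, 1, -114, -302⟩ : WeierstrassCurve ℤ).map (Int.castRingHom ℚ)).HasSurjectiveModNGaloisRep (5 : ℕ) := by
  have hi : IsSquare (((((23 : ℕ) : ℤ) + 1 - (28 : ℕ) : ℤ) : ZMod 5) ^ 2 - 4 * ((23 : ℕ) : ZMod 5)) ∧
      ((((23 : ℕ) : ℤ) + 1 - (28 : ℕ) : ℤ) : ZMod 5) ^ 2 - 4 * ((23 : ℕ) : ZMod 5) ≠ 0 ∧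
        ((((23 : ℕ) : ℤ) + 1 - (28 : ℕ) : ℤ) : ZMod 5) ≠ 0 := by
    decide +kernel
  have hii : ¬ IsSquare (((((3 : ℕ) : ℤ) + 1 - (2 : ℕ) : ℤ) : ZMod 5) ^ 2 - 4 * ((3 : ℕ) : ZMod 5)) ∧
      ((((3 : ℕ) : ℤ) + 1 - (2 : ℕ) : ℤ) : ZMod 5) ≠ 0 := by
    decide +kernel
  have hiii : ∃ u : ZMod 5, ((((3 : ℕ) : ℤ) + 1 - (2 : ℕ) : ℤ) : ZMod 5) ^ 2 = u * ((3 : ℕ) : ZMod 5) ∧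
      u ≠ 0 ∧ u ≠ 1 ∧ u ≠ 2 ∧ u ≠ 4 ∧ u ^ 2 - 3 * u + 1 ≠ 0 := ⟨3, by decide +kernel⟩
  haveI := Fact.mk (by norm_num : Nat.Prime 3)
  haveI := Fact.mk (by norm_num : Nat.Prime 5)
  haveI := Fact.mk (by norm_num : Nat.Prime 23)
  haveI := minTwist7_isElliptic
  haveI := minTwist7_isGloballyMinimal
  exact IntModel.hasSurjectiveModNGaloisRep_of_intModel_of_serreWitnesses minTwist7_intModel 5 (by norm_num) 23 3 3
    (by norm_num) (by norm_num) (by norm_num) (by decide +kernel) (by decide +kernel) (by decide +kernel)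
    (n₁ := 28) (n₂ := 2) (n₃ := 2) minTwist7_card_23 minTwist7_card_3 minTwist7_card_3 hi hii hiii

/-- **`T` is not CM** (multiplicative reduction at `389`: `389 ∣ Δ_T`, `389 ∤ c₄(T) = 5488`; a CM curve has integral `j`).
[cite: SilvermanATAEC1994, Thm. II.6.4 (PDF p. 148)] -/
theorem minTwist7_not_hasCM :
    haveI := minTwist7_isElliptic;
    ¬ ((⟨0, -1, 1, -114, -302⟩ : WeierstrassCurve ℤ).map (Int.castRingHom ℚ)).HasCM := by
  haveI := minTwist7_isElliptic
  haveI := minTwist7_isGloballyMinimal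
  haveI := Fact.mk (by norm_num : Nat.Prime 389)
  intro hCM
  exact not_hasMultiplicativeReductionAtPrime_of_hasCM _ hCM 389
    (IntModel.hasMultiplicativeReductionAtPrime_of_intModel minTwist7_intModel 389 (by decide +kernel)
      (by decide +kernel))

/-- **Kodaira–Néron for `T` at `5`**: `5 ∤ ord_v(Δ_T)` at every multiplicative place (`|Δ_T| < 35^5`; prime-power
factorisation `7^6`, `389^1`, read by the table `not_dvd_ordMinimalDiscriminant_of_intModel_table` with the
exponents supplied by hand from the factorisation). Hence `5 ∤ Tam(T)` (`not_dvd_tamagawaProduct_of_kodairaNeron`: `c_v ≤ 4 < 5` at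
additive `v`). [cite: SilvermanAEC2009, VII.5.1, VIII.8, C.15 Table 15.1] -/
theorem minTwist7_kodairaNeron_5 :
    haveI := minTwist7_isElliptic; haveI := minTwist7_isGloballyMinimal;
    ∀ v : HeightOneSpectrum (𝓞 ℚ),
      ((⟨0, -1, 1, -114, -302⟩ : WeierstrassCurve ℤ).map (Int.castRingHom ℚ)).HasMultiplicativeReductionAt v →
      ¬ 5 ∣ ((⟨0, -1, 1, -114, -302⟩ : WeierstrassCurve ℤ).map (Int.castRingHom ℚ)).ordMinimalDiscriminant v := by
  haveI := minTwist7_isElliptic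
  haveI := minTwist7_isGloballyMinimal
  exact not_dvd_ordMinimalDiscriminant_of_intModel_table minTwist7_intModel (p := 5) (Δ₀ := 45765461)
    (by decide +kernel) (B := 35) (by decide +kernel)
    (by
      intro q hq hqP hqd
      have hn : ((45765461 : ℤ).natAbs) = 7 ^ 6 * (389 ^ 1) := by norm_num
      rw [hn] at hqd ⊢
      rcases (Nat.Prime.dvd_mul hqP).mp hqd with h | h0
      · obtain rfl := (Nat.prime_dvd_prime_iff_eq hqP (by norm_num)).mp (hqP.dvd_of_dvd_pow h)
        exact ⟨6, by simp, by decide +kernel, by decide +kernel, by norm_num⟩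
      · obtain rfl := (Nat.prime_dvd_prime_iff_eq hqP (by norm_num)).mp (hqP.dvd_of_dvd_pow h0)
        exact absurd (Finset.mem_range.mp hq) (by norm_num)
      )

/-! ## The rank-one datum as a BSD-quotient valuation (BCS 2025 Cor. 1.3.1, GZK, by name) -/

/-- **THE RANK-ONE DATUM OF THE `389a1` ROW AT `d_K = -7` AS ONE BSD-QUOTIENT VALUATION (Burungale–Castella–Skinner 2025
Cor. 1.3.1 + GZK by name).** For the Heegner twist `T = 389a1^{(-7)}` (minimal model `T₀ = [0, -1, 1, -114, -302]`): IF `ord_{s=1} L(T,s) = 1`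
and the rational number `L'(T,1)/(Ω_T·Reg_T)` has `ord_5 ≤ 0`, THEN `#Sel_5(T/ℚ) = 5`. Chain (generic
`natCard_selmerGroup_eq_of_rankOne_bsdQuotient_bcs`): GZK (`hGZK`): rank `T = 1`, `Ш(T)` finite; BCS Cor. 1.3.1 (`hBCS`; non-CM, good
ordinary `5`, `ρ̄_{T,5}` onto ⟹ `T[5]` irreducible and (im)): `ord_5(L'(T,1)/(Ω_T Reg_T)) = ord_5 #Ш(T) + ord_5 Tam(T)`;
Kodaira–Néron: `5 ∤ Tam(T)`; so `5 ∤ #Ш(T)`, `Ш(T)[5] = 0`, `#Sel_5(T) = 5^{rank T} = 5`. CONDITIONAL on the two named facts;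
per curve; BSD is not proved by it. [cite: BurungaleCastellaSkinner2025, Cor. 1.3.1 (p. 4)] [cite: Darmon2004, Thm. 3.22]
[cite: SilvermanAEC2009, Thm. X.4.2] -/
theorem minTwist7_natCard_selmerGroup_eq_of_bsdQuotient
    (hBCS : BurungaleCastellaSkinner2025.cor131_padicValRat_bsd_rank_le_one) (hGZK : rank_eq_analyticRank_of_analyticRank_le_one)
    (hr : haveI := minTwist7_isElliptic;
      ((⟨0, -1, 1, -114, -302⟩ : WeierstrassCurve ℤ).map (Int.castRingHom ℚ)).analyticRank = 1)
    (hval : haveI := minTwist7_isElliptic; haveI := minTwist7_isGloballyMinimal;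
      ∀ q : ℚ, ((⟨0, -1, 1, -114, -302⟩ : WeierstrassCurve ℤ).map (Int.castRingHom ℚ)).leadingLCoeff /
          (((((⟨0, -1, 1, -114, -302⟩ : WeierstrassCurve ℤ).map (Int.castRingHom ℚ)).realPeriodRat *
              ((⟨0, -1, 1, -114, -302⟩ : WeierstrassCurve ℤ).map (Int.castRingHom ℚ)).regulator : ℝ)) : ℂ) = (q : ℂ) →
        padicValRat 5 q ≤ 0) :
    haveI := minTwist7_isElliptic;
    Nat.card (((⟨0, -1, 1, -114, -302⟩ : WeierstrassCurve ℤ).map (Int.castRingHom ℚ)).selmerGroup (5 : ℕ)) = 5 := by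
  haveI := minTwist7_isElliptic
  haveI := minTwist7_isGloballyMinimal
  haveI := Fact.mk (by norm_num : Nat.Prime 5)
  exact natCard_selmerGroup_eq_of_rankOne_bsdQuotient_bcs hBCS hGZK _ 5 (by norm_num) minTwist7_not_hasCM
    minTwist7_goodOrdinary_5.1 minTwist7_goodOrdinary_5.2 minTwist7_hasSurjectiveModNGaloisRep_5 minTwist7_kodairaNeron_5
    hr hval

/-- **The same datum on the tree's twist `E.quadraticTwist (-7)`** (`E = 389a1`): under the two rank-one hypotheses,
`#Sel_5(E^{(-7)}/ℚ) = 5` — transported along the `ℚ`-isomorphism `minTwist7_smul_eq` (`natCard_selmerGroup_eq_of_variableChange`):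
the hypothesis `hT : #Sel_5(E^{(d_K)}) ≤ 5` of `C389a1.cruxBody_of_twistSelmer` for every `K` with `d_K = -7`. CONDITIONAL on
BCS Cor. 1.3.1 and GZK by name; per curve; BSD is not proved by it. [cite: BurungaleCastellaSkinner2025, Cor. 1.3.1 (p. 4)]
[cite: Darmon2004, Thm. 3.22] [cite: SilvermanAEC2009, X.§4] -/
theorem natCard_selmerGroup_quadraticTwist_neg7_eq_of_bsdQuotient
    (hBCS : BurungaleCastellaSkinner2025.cor131_padicValRat_bsd_rank_le_one) (hGZK : rank_eq_analyticRank_of_analyticRank_le_one)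
    (hr : haveI := minTwist7_isElliptic;
      ((⟨0, -1, 1, -114, -302⟩ : WeierstrassCurve ℤ).map (Int.castRingHom ℚ)).analyticRank = 1)
    (hval : haveI := minTwist7_isElliptic; haveI := minTwist7_isGloballyMinimal;
      ∀ q : ℚ, ((⟨0, -1, 1, -114, -302⟩ : WeierstrassCurve ℤ).map (Int.castRingHom ℚ)).leadingLCoeff /
          (((((⟨0, -1, 1, -114, -302⟩ : WeierstrassCurve ℤ).map (Int.castRingHom ℚ)).realPeriodRat *
              ((⟨0, -1, 1, -114, -302⟩ : WeierstrassCurve ℤ).map (Int.castRingHom ℚ)).regulator : ℝ)) : ℂ) = (q : ℂ) →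
        padicValRat 5 q ≤ 0) :
    haveI := curve389a1_isGloballyMinimal;
    Nat.card ((Curve389a1.E.quadraticTwist ((-7) : ℚ)).selmerGroup (5 : ℕ)) = 5 := by
  haveI := curve389a1_isGloballyMinimal
  rw [← natCard_selmerGroup_eq_of_variableChange ((5 : ℕ) : ℤ) minTwist7_smul_eq]
  exact minTwist7_natCard_selmerGroup_eq_of_bsdQuotient hBCS hGZK hr hval

/-- **THE CRUX `KolyvaginDepthSupplyKN` AT `389a1`, MODULO PRINT AND ONE BSD-QUOTIENT VALUATION.** Granted the named print facts
(Stein–Wuthrich 2013 Thm. 1.1, (γ) = Gross 1991 Prop. 3.7 (2), W. Zhang 2014 Lemma 8.4 (1) / Thm. 9.1; Burungale–Castella–Skinner 2025 Cor. 1.3.1; Gross–Zagier–Kolyvagin) and, for ONE imaginary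
quadratic `K` with `d_K = -7`, the two rank-one hypotheses on the Heegner twist `T = E^{(-7)}` — `ord_{s=1} L(T,s) = 1` and
`ord_5(L'(T,1)/(Ω_T·Reg_T)) ≤ 0` (numerically: `#Ш_an(T) = 1`, `5 ∤ c(T)`, observatory `CERT-TABLE.md`) — the CLAUSE of the crux holds at
`W = 389a1` VERBATIM (`C389a1.cruxBody_of_twistSelmer` fed with `natCard_selmerGroup_quadraticTwist_neg7_eq_of_bsdQuotient`). The
even-rank analogue of g18's `cruxBody_of_twistLValue`: the anticyclotomic depth door at a rank-two curve, read through the printed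
rank-one BSD formula of its Heegner twist. CONDITIONAL on the named facts and the two hypotheses; per curve (the open stub (S♭) is
untouched); BSD is not proved by it. [cite: SteinWuthrich2013, Thm. 1.1 (p. 1758)] [cite: WZhang2014, Lemma 8.4 (1) (p. 236), Thm. 9.1 (p. 240)] [cite: GrossLMS1991, Prop. 3.7 (2)]
[cite: BurungaleCastellaSkinner2025, Cor. 1.3.1 (p. 4)] [cite: Darmon2004, Thm. 3.22] [cite: CremonaAlgorithms1997, Table 1 (389a1)] -/
theorem cruxBody_of_twistBSDQuotient
    (hSW : SteinWuthrich2013_sha_inf_torsionBy_eq_bot_of_two_le_rank)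
    (h372 : GrossLMS1991.prop37_2_frobeniusCongruence)
    (h84 : Literature.NumberTheory.EllipticCurves.WZhang2014_lemma84_exists_minimal_kolyvaginClass_one_selmerCard)
    (hBCS : BurungaleCastellaSkinner2025.cor131_padicValRat_bsd_rank_le_one) (hGZK : rank_eq_analyticRank_of_analyticRank_le_one)
    (K : Type) [Field K] [NumberField K] (hK : IsImaginaryQuadratic K) (hD : NumberField.discr K = -7)
    (hr : haveI := minTwist7_isElliptic;
      ((⟨0, -1, 1, -114, -302⟩ : WeierstrassCurve ℤ).map (Int.castRingHom ℚ)).analyticRank = 1)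
    (hval : haveI := minTwist7_isElliptic; haveI := minTwist7_isGloballyMinimal;
      ∀ q : ℚ, ((⟨0, -1, 1, -114, -302⟩ : WeierstrassCurve ℤ).map (Int.castRingHom ℚ)).leadingLCoeff /
          (((((⟨0, -1, 1, -114, -302⟩ : WeierstrassCurve ℤ).map (Int.castRingHom ℚ)).realPeriodRat *
              ((⟨0, -1, 1, -114, -302⟩ : WeierstrassCurve ℤ).map (Int.castRingHom ℚ)).regulator : ℝ)) : ℂ) = (q : ℂ) →
        padicValRat 5 q ≤ 0) :
    haveI := curve389a1_isGloballyMinimal;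
    ∃ (p : ℕ) (hp : Fact p.Prime), 5 ≤ p ∧ Curve389a1.E.HasGoodReductionAtPrime p ∧
      ¬ (p : ℤ) ∣ Curve389a1.E.frobeniusTrace p ∧ (∀ n : ℕ, Curve389a1.E.HasSurjectiveModNGaloisRep (p ^ n : ℕ)) ∧
      (∀ v : HeightOneSpectrum (𝓞 ℚ), Curve389a1.E.HasMultiplicativeReductionAt v →
        ¬ p ∣ Curve389a1.E.ordMinimalDiscriminant v) ∧
      ∃ (K : Type) (_ : Field K) (_ : NumberField K), IsImaginaryQuadratic K ∧
        NumberField.discr K ≠ -3 ∧ NumberField.discr K ≠ -4 ∧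
        ∃ (_ : NeZero (Curve389a1.E.conductorNorm ℤ)), SatisfiesHeegnerHypothesis (Curve389a1.E.conductorNorm ℤ) K ∧
        ∃ (Dt : ModularParametrizationData Curve389a1.E (Curve389a1.E.conductorNorm ℤ)) (β : ℤ) (ι : K →+* ℂ) (n₁ : ℕ)
          (d : KolyvaginHeegnerData Dt β ι n₁), Squarefree n₁ ∧
          (∀ q ∈ n₁.primeFactors, Zhang2014.IsKolyvaginPrime (Curve389a1.E.conductorNorm ℤ) Curve389a1.E K p q) ∧
          d.kolyvaginClass hp.out 1 ≠ 0 ∧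
          (n₁.primeFactors.card + 1 ≤ Curve389a1.E.mordellWeilRank ∨
            (n₁.primeFactors.card ≤ Curve389a1.E.mordellWeilRank ∧
              n₁.primeFactors.card + 1 ≤ (Curve389a1.E.quadraticTwist (NumberField.discr K : ℚ)).mordellWeilRank)) := by
  haveI := curve389a1_isGloballyMinimal
  have h1 := natCard_selmerGroup_quadraticTwist_neg7_eq_of_bsdQuotient hBCS hGZK hr hval
  refine cruxBody_of_twistSelmer hSW h372 h84 K hK hD ?_
  have hcast : (NumberField.discr K : ℚ) = ((-7) : ℚ) := by rw [hD]; norm_num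
  rw [hcast, h1]

end C389a1

end Summit.BirchSwinnertonDyer.BirchSwinnertonDyer.Theorems.KolyvaginDepthDoor

end
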